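import Mathlib.Algebra.BigOperators.Fin
import Mathlib.Data.Matrix.Mul
import Mathlib.Data.ZMod.Basic
import Mathlib.Tactic
import HarnessLib

/-!
# Reduced words in the four `{111}` reflections of `D₊`: the `3`-adic normal form and the free product `(ℤ/2)^{*4}`
# (crux `CoaxialWallLaw`, stmt-Ventures-19481, line `WallLedgerF`; item (L1) of the module-capture plan)

HONEST FRAMING. Venture `Summits/Ventures/Crystal3D` (cell `crystal3d-full`), helper `--supports` the crux `CoaxialWallLaw`
of `route-Ventures-StickyWulffConstant` (REGISTERED line `WallLedgerF`, skeleton `Certificates` v3, registered stub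
`stub_moduleCapture`).  Item (L1) of HOME/wall-19481-p2/MODULE-CAPTURE-PLAN-g10.md §4 (evidence #47 on the crux item): the
SELF-CONTAINED ALGEBRA of the chain frames.  Rung credit only; F-C1 not moved; census-free, no kissing facts.

Setting: INTEGER CUBIC COORDINATES (`√2 ×` the tree's `cubicCoords`; slots of `D₊` = `NearIdentity.slotInt`, the twelve
`(±1,±1,0)`-type vectors).  The four `{111}` normals of `D₊` are `n₀ = (−1,1,1)` (basal: `cubicCoords e₃ = n₀/√3`) and
`n₁, n₂, n₃ = (1,1,1), (−1,−1,1), (−1,1,−1)` (the inclined normals `inclinedNormal 0, 1, 2`, `× √3`); the reflections are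
`M_i = 1 − ⅔ nᵢnᵢᵀ ∈ GL₃(⅓ℤ)` with tripled integer forms `N_i = 3 − 2 nᵢnᵢᵀ`.  Words are `List (Fin 4)`, REDUCED means
`List.IsChain (· ≠ ·)` (no two equal neighbours), `wordMat [i₁,…,i_k] = M_{i₁} ⋯ M_{i_k}`.

* `red_wordMatZ` — **the `3`-adic normal form**: for a non-empty reduced word, `N_{i₁} ⋯ N_{i_k} ≡ ± n_{i₁} n_{i_k}ᵀ (mod 3)`
  (induction on `3M_i ≡ nᵢnᵢᵀ` and `nᵢᵀnⱼ = ±1` for `i ≠ j`; the finite tables are kernel-decided over `ZMod 3`);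
* `not_dvd_wordMatZ`, `wordMat_apply_ne_intCast` — hence EVERY entry of `M_w` has denominator exactly `3^k`: no entry is an
  integer, `M_w ≠ 1` (`wordMat_ne_one`);
* `eq_of_wordMat_eq` — **reduced-word injectivity** (`Γ₀ := ⟨M₀,…,M₃⟩ ≅ (ℤ/2)^{*4}`): equal matrices ⇒ equal lengths
  (denominators), equal first/last letters (residues), then cancel and induct; inverses are reversed words
  (`wordMat_reverse_mul`);
* `wordMat_mulVec_apply_ne_intCast` — **no return to the lattice**: for an integer vector `x` with `n_{i_k} ⬝ x ≢ 0 (mod 3)`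
  no coordinate of `M_w x` is an integer.
The free reduction `reduce`, the normal-form theorem, `Γ₀ ∩ GL₃(ℤ) = {1}` and the slot-dozen corollaries (trivial
stabiliser of `D₊`, rigidity of slot images) are in `…ReflectionWordsNormalForm`; the transport to `EuclideanSpace ℝ (Fin 3)`
(`cubicCoords`, `fccSlots`, the reflections `(ℝ ∙ n)ᗮ.reflection` in the recursion of `PlateSystem.Fw`) follows it.
WHAT THIS IS NOT: not the stub, no statement about configurations; F-C1 not moved.
-/

namespace Summit.Ventures.Crystal3D.Theorems

namespace ReflWord

open Matrix

/-- The four `{111}` normals of `D₊` in INTEGER CUBIC COORDINATES (`√2 ×` the tree's `cubicCoords`, rescaled to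
norm `√3`): letter `0` is the BASAL normal `(−1, 1, 1)` (`cubicCoords e₃ = (−1,1,1)/√3`, `cubeInt 4`), letters
`1, 2, 3` are the three INCLINED normals `(1,1,1), (−1,−1,1), (−1,1,−1)` (`= inclinedNormal 0, 1, 2` up to the
factor `1/√3`; `cubeInt 0, 6, 5`). -/
def nrm : Fin 4 → Fin 3 → ℤ := ![![-1, 1, 1], ![1, 1, 1], ![-1, -1, 1], ![-1, 1, -1]]

/-- The normals reduced mod `3`. -/
def nbar (i : Fin 4) : Fin 3 → ZMod 3 := fun a => (nrm i a : ZMod 3)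

/-- The normals as rational vectors. -/
def nrmQ (i : Fin 4) : Fin 3 → ℚ := fun a => (nrm i a : ℚ)

/-- The TRIPLED reflection `N_i = 3·M_i = 3 − 2 nᵢ nᵢᵀ`, an integer matrix. -/
def N (i : Fin 4) : Matrix (Fin 3) (Fin 3) ℤ := (3 : ℤ) • (1 : Matrix (Fin 3) (Fin 3) ℤ) - (2 : ℤ) • vecMulVec (nrm i) (nrm i)

/-- The reflection `M_i = 1 − (2/3) nᵢ nᵢᵀ` across the plane `nᵢ^⊥`, a rational orthogonal matrix with entries in `⅓ℤ`. -/
def M (i : Fin 4) : Matrix (Fin 3) (Fin 3) ℚ := 1 - (2 / 3 : ℚ) • vecMulVec (nrmQ i) (nrmQ i)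

/-- The matrix of a word: `wordMat [i₁, …, i_k] = M_{i₁} ⋯ M_{i_k}`. -/
def wordMat (w : List (Fin 4)) : Matrix (Fin 3) (Fin 3) ℚ := (w.map M).prod

/-- The tripled integer form: `wordMatZ [i₁, …, i_k] = N_{i₁} ⋯ N_{i_k} = 3^k · wordMat`. -/
def wordMatZ (w : List (Fin 4)) : Matrix (Fin 3) (Fin 3) ℤ := (w.map N).prod


/-- Integer matrices as rational matrices. -/
def castM : Matrix (Fin 3) (Fin 3) ℤ →+* Matrix (Fin 3) (Fin 3) ℚ := (Int.castRingHom ℚ).mapMatrix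

/-- Integer matrices reduced mod `3`. -/
def red : Matrix (Fin 3) (Fin 3) ℤ →+* Matrix (Fin 3) (Fin 3) (ZMod 3) := (Int.castRingHom (ZMod 3)).mapMatrix

/-- Entries of the cast matrix. -/
@[simp] theorem castM_apply (A : Matrix (Fin 3) (Fin 3) ℤ) (a b : Fin 3) : castM A a b = (A a b : ℚ) := rfl

/-- Entries of the reduced matrix. -/
@[simp] theorem red_apply (A : Matrix (Fin 3) (Fin 3) ℤ) (a b : Fin 3) : red A a b = (A a b : ZMod 3) := rfl

/-! ### Finite tables (kernel-decided) -/

/-- `nᵢ ⬝ nⱼ = ±1` for `i ≠ j` (and `3` for `i = j`), mod `3`. -/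
theorem nbar_dot_cases : ∀ i j : Fin 4, i ≠ j → nbar i ⬝ᵥ nbar j = 1 ∨ nbar i ⬝ᵥ nbar j = -1 := by decide

/-- `N_i ≡ nᵢ nᵢᵀ (mod 3)`. -/
theorem red_N : ∀ i : Fin 4, red (N i) = vecMulVec (nbar i) (nbar i) := by decide

/-- The entries of `± n_h n_lᵀ` are units mod `3`. -/
theorem smul_vecMulVec_apply_ne_zero : ∀ (h l : Fin 4) (ε : ZMod 3), ε = 1 ∨ ε = -1 →
    ∀ a b : Fin 3, (ε • vecMulVec (nbar h) (nbar l)) a b ≠ 0 := by decide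

/-- `± n_h n_lᵀ ≡ ± n_{h'} n_{l'}ᵀ (mod 3)` forces `h = h'` and `l = l'` (the four normals are pairwise independent mod `3`). -/
theorem eq_of_smul_vecMulVec_eq : ∀ (h l h' l' : Fin 4) (ε ε' : ZMod 3), (ε = 1 ∨ ε = -1) → (ε' = 1 ∨ ε' = -1) →
    ε • vecMulVec (nbar h) (nbar l) = ε' • vecMulVec (nbar h') (nbar l') → h = h' ∧ l = l' := by decide

/-! ### The letters -/

/-- `M_i = ⅓ N_i`. -/
theorem M_eq (i : Fin 4) : M i = (1 / 3 : ℚ) • castM (N i) := by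
  ext a b
  simp only [M, N, castM_apply, vecMulVec_apply, nrmQ, Matrix.sub_apply, Matrix.smul_apply, Matrix.one_apply,
    smul_eq_mul]
  split_ifs <;> push_cast <;> ring

/-- `nᵢ ⬝ nᵢ = 3` over `ℚ`. -/
theorem nrmQ_dot_self (i : Fin 4) : nrmQ i ⬝ᵥ nrmQ i = 3 := by
  fin_cases i <;> simp [nrmQ, nrm, dotProduct, Fin.sum_univ_three] <;> norm_num

/-- `M_i² = 1`: each letter is an involution. -/
theorem M_mul_self (i : Fin 4) : M i * M i = 1 := by
  have hV : vecMulVec (nrmQ i) (nrmQ i) * vecMulVec (nrmQ i) (nrmQ i) = (3 : ℚ) • vecMulVec (nrmQ i) (nrmQ i) := by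
    rw [vecMulVec_mul_vecMulVec, nrmQ_dot_self, vecMulVec_smul]
  rw [M, sub_mul, mul_sub, mul_sub, one_mul, one_mul, mul_one, Matrix.smul_mul, Matrix.mul_smul, hV, smul_smul,
    smul_smul]
  module

/-- The empty word is the identity. -/
@[simp] theorem wordMat_nil : wordMat [] = 1 := rfl

/-- `wordMat (i :: w) = M_i * wordMat w`. -/
@[simp] theorem wordMat_cons (i : Fin 4) (w : List (Fin 4)) : wordMat (i :: w) = M i * wordMat w := rfl

/-- The empty word is the identity (tripled form). -/
@[simp] theorem wordMatZ_nil : wordMatZ [] = 1 := rfl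

/-- `wordMatZ (i :: w) = N_i * wordMatZ w`. -/
@[simp] theorem wordMatZ_cons (i : Fin 4) (w : List (Fin 4)) : wordMatZ (i :: w) = N i * wordMatZ w := rfl

/-- `wordMat (u ++ v) = wordMat u * wordMat v`. -/
theorem wordMat_append (u v : List (Fin 4)) : wordMat (u ++ v) = wordMat u * wordMat v := by
  simp [wordMat, List.map_append, List.prod_append]

/-- Equal head letters cancel. -/
theorem wordMat_cons_cons_self (i : Fin 4) (w : List (Fin 4)) : wordMat (i :: i :: w) = wordMat w := by
  rw [wordMat_cons, wordMat_cons, ← mul_assoc, M_mul_self, one_mul]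

/-- The reversed word is the inverse: `wordMat w.reverse * wordMat w = 1`. -/
theorem wordMat_reverse_mul (w : List (Fin 4)) : wordMat w.reverse * wordMat w = 1 := by
  induction w with
  | nil => simp
  | cons i w ih =>
    rw [List.reverse_cons, wordMat_append, wordMat_cons, wordMat_cons, wordMat_nil, mul_one, mul_assoc,
      ← mul_assoc (M i), M_mul_self, one_mul, ih]

/-- `wordMat w * wordMat w.reverse = 1`. -/
theorem wordMat_mul_reverse (w : List (Fin 4)) : wordMat w * wordMat w.reverse = 1 := by
  simpa using wordMat_reverse_mul w.reverse

/-- **`wordMat = 3^{-k} · wordMatZ`.** -/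
theorem wordMat_eq (w : List (Fin 4)) : wordMat w = ((1 / 3 : ℚ) ^ w.length) • castM (wordMatZ w) := by
  induction w with
  | nil => simp [wordMat, wordMatZ]
  | cons i w ih =>
    rw [wordMat_cons, wordMatZ_cons, ih, M_eq, map_mul, Matrix.smul_mul, Matrix.mul_smul, smul_smul, List.length_cons,
      pow_succ']

/-- Entries: `wordMat w a b = wordMatZ w a b / 3^k`. -/
theorem wordMat_apply (w : List (Fin 4)) (a b : Fin 3) : wordMat w a b = (wordMatZ w a b : ℚ) / 3 ^ w.length := by
  rw [wordMat_eq, Matrix.smul_apply, castM_apply, smul_eq_mul, one_div, inv_pow, mul_comm, div_eq_mul_inv]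

/-! ### The `3`-adic normal form -/

/-- **`3`-ADIC NORMAL FORM.**  For a non-empty reduced word `w = i₁ ⋯ i_k`:
`3^k · M_w = N_{i₁} ⋯ N_{i_k} ≡ ± n_{i₁} n_{i_k}ᵀ (mod 3)`. -/
theorem red_wordMatZ (w : List (Fin 4)) (hw : w ≠ []) (hred : w.IsChain (· ≠ ·)) :
    ∃ ε : ZMod 3, (ε = 1 ∨ ε = -1) ∧ red (wordMatZ w) = ε • vecMulVec (nbar (w.head hw)) (nbar (w.getLast hw)) := by
  induction w with
  | nil => exact absurd rfl hw
  | cons i u ih =>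
    cases u with
    | nil => exact ⟨1, Or.inl rfl, by simp [wordMatZ, red_N]⟩
    | cons j u' =>
      have hij : i ≠ j := (List.isChain_cons_cons.1 hred).1
      have hred' : (j :: u').IsChain (· ≠ ·) := (List.isChain_cons_cons.1 hred).2
      obtain ⟨ε, hε, hP⟩ := ih (List.cons_ne_nil j u') hred'
      have hlast : (i :: j :: u').getLast hw = (j :: u').getLast (List.cons_ne_nil j u') :=
        List.getLast_cons (List.cons_ne_nil j u')
      rw [hlast, wordMatZ_cons, map_mul, hP, red_N, Matrix.mul_smul, vecMulVec_mul_vecMulVec, vecMulVec_smul, smul_smul]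
      simp only [List.head_cons] at *
      rcases nbar_dot_cases i j hij with h1 | h1 <;> rw [h1]
      · exact ⟨ε * 1, by rcases hε with rfl | rfl <;> simp, rfl⟩
      · exact ⟨ε * -1, by rcases hε with rfl | rfl <;> simp, rfl⟩

/-- **DENOMINATOR EXACTLY `3^k`.**  No entry of `N_{i₁} ⋯ N_{i_k}` is divisible by `3` (non-empty reduced word). -/
theorem not_dvd_wordMatZ (w : List (Fin 4)) (hw : w ≠ []) (hred : w.IsChain (· ≠ ·)) (a b : Fin 3) :
    ¬ (3 : ℤ) ∣ wordMatZ w a b := by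
  obtain ⟨ε, hε, hP⟩ := red_wordMatZ w hw hred
  intro hd
  have h0 : red (wordMatZ w) a b = 0 := by
    rw [red_apply]
    exact (ZMod.intCast_zmod_eq_zero_iff_dvd _ 3).2 (by exact_mod_cast hd)
  rw [hP] at h0
  exact smul_vecMulVec_apply_ne_zero _ _ ε hε a b h0

/-- **No entry of `M_w` is an integer** for a non-empty reduced word `w`; in particular `M_w ∉ GL₃(ℤ) ⊇ O_h` and `M_w ≠ 1`. -/
theorem wordMat_apply_ne_intCast (w : List (Fin 4)) (hw : w ≠ []) (hred : w.IsChain (· ≠ ·)) (a b : Fin 3) (z : ℤ) :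
    wordMat w a b ≠ z := by
  intro h
  rw [wordMat_apply, div_eq_iff (by positivity)] at h
  obtain ⟨k, hk⟩ : ∃ k, w.length = k + 1 := Nat.exists_eq_add_one_of_ne_zero (by simpa using List.length_pos_of_ne_nil hw |>.ne')
  apply not_dvd_wordMatZ w hw hred a b
  refine ⟨z * 3 ^ k, ?_⟩
  rw [hk, pow_succ] at h
  exact_mod_cast (by rw [h]; ring : (wordMatZ w a b : ℚ) = 3 * (z * 3 ^ k))

/-- A non-empty reduced word is not the identity. -/
theorem wordMat_ne_one (w : List (Fin 4)) (hw : w ≠ []) (hred : w.IsChain (· ≠ ·)) : wordMat w ≠ 1 := by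
  intro h
  have := wordMat_apply_ne_intCast w hw hred 0 0 1
  rw [h] at this
  exact this (by simp)


/-! ### Reduced words are determined by their matrices: `Γ₀ ≅ (ℤ/2)^{*4}` -/

/-- `m / 3^k` with `3 ∤ m` and `k ≥ 1` is not an integer. -/
theorem div_pow_ne_intCast {m : ℤ} {k : ℕ} (hk : k ≠ 0) (hm : ¬ (3 : ℤ) ∣ m) (z : ℤ) : (m : ℚ) / 3 ^ k ≠ z := by
  intro h
  rw [div_eq_iff (by positivity)] at h
  obtain ⟨j, rfl⟩ := Nat.exists_eq_add_one_of_ne_zero hk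
  apply hm
  refine ⟨z * 3 ^ j, ?_⟩
  rw [pow_succ] at h
  exact_mod_cast (by rw [h]; ring : (m : ℚ) = 3 * (z * 3 ^ j))

/-- Two non-empty reduced words with the same matrix have the same length (compare denominators). -/
theorem length_eq_of_wordMat_eq {w w' : List (Fin 4)} (hw : w ≠ []) (hred : w.IsChain (· ≠ ·)) (hw' : w' ≠ [])
    (hred' : w'.IsChain (· ≠ ·)) (h : wordMat w = wordMat w') : w.length = w'.length := by
  have key : ∀ {u v : List (Fin 4)}, v ≠ [] → v.IsChain (· ≠ ·) → wordMat u = wordMat v → ¬ u.length < v.length := by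
    intro u v hv hrv huv hlt
    have h00 := congr_fun (congr_fun huv 0) 0
    rw [wordMat_apply, wordMat_apply, div_eq_div_iff (by positivity) (by positivity)] at h00
    obtain ⟨d, hd⟩ := Nat.exists_eq_add_of_lt hlt
    apply not_dvd_wordMatZ v hv hrv 0 0
    refine ⟨wordMatZ u 0 0 * 3 ^ d, ?_⟩
    have h3 : (3 : ℚ) ^ u.length ≠ 0 := by positivity
    rw [hd, show u.length + d + 1 = u.length + (d + 1) by ring, pow_add] at h00
    have hv' : (wordMatZ v 0 0 : ℚ) = wordMatZ u 0 0 * 3 ^ (d + 1) := by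
      apply mul_right_cancel₀ h3
      rw [← h00]; ring
    exact_mod_cast (by rw [hv']; ring : (wordMatZ v 0 0 : ℚ) = 3 * (wordMatZ u 0 0 * 3 ^ d))
  rcases Nat.lt_trichotomy w.length w'.length with hlt | heq | hgt
  · exact absurd hlt (key hw' hred' h)
  · exact heq
  · exact absurd hgt (key hw hred h.symm)

/-- Two non-empty reduced words with the same matrix have the same tripled integer form. -/
theorem wordMatZ_eq_of_wordMat_eq {w w' : List (Fin 4)} (hw : w ≠ []) (hred : w.IsChain (· ≠ ·)) (hw' : w' ≠ [])
    (hred' : w'.IsChain (· ≠ ·)) (h : wordMat w = wordMat w') : wordMatZ w = wordMatZ w' := by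
  have hlen := length_eq_of_wordMat_eq hw hred hw' hred' h
  ext a b
  have hab := congr_fun (congr_fun h a) b
  rw [wordMat_apply, wordMat_apply, hlen, div_left_inj' (by positivity)] at hab
  exact_mod_cast hab

/-- Two non-empty reduced words with the same matrix have the same FIRST and the same LAST letter (read off mod `3`). -/
theorem head_eq_of_wordMat_eq {w w' : List (Fin 4)} (hw : w ≠ []) (hred : w.IsChain (· ≠ ·)) (hw' : w' ≠ [])
    (hred' : w'.IsChain (· ≠ ·)) (h : wordMat w = wordMat w') :
    w.head hw = w'.head hw' ∧ w.getLast hw = w'.getLast hw' := by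
  have hZ := wordMatZ_eq_of_wordMat_eq hw hred hw' hred' h
  obtain ⟨ε, hε, hP⟩ := red_wordMatZ w hw hred
  obtain ⟨ε', hε', hP'⟩ := red_wordMatZ w' hw' hred'
  rw [hZ, hP'] at hP
  obtain ⟨h1, h2⟩ := eq_of_smul_vecMulVec_eq _ _ _ _ ε' ε hε' hε hP
  exact ⟨h1.symm, h2.symm⟩

/-- **REDUCED-WORD INJECTIVITY** (`Γ₀ = ⟨M₀, M₁, M₂, M₃⟩ ≅ (ℤ/2)^{*4}`: distinct reduced words are distinct matrices). -/
theorem eq_of_wordMat_eq : ∀ {w w' : List (Fin 4)}, w.IsChain (· ≠ ·) → w'.IsChain (· ≠ ·) →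
    wordMat w = wordMat w' → w = w'
  | [], [], _, _, _ => rfl
  | [], j :: u', _, hred', h => absurd h.symm (wordMat_ne_one _ (List.cons_ne_nil j u') hred')
  | i :: u, [], hred, _, h => absurd h (wordMat_ne_one _ (List.cons_ne_nil i u) hred)
  | i :: u, j :: u', hred, hred', h => by
      obtain ⟨hij, -⟩ := head_eq_of_wordMat_eq (List.cons_ne_nil i u) hred (List.cons_ne_nil j u') hred' h
      simp only [List.head_cons] at hij
      subst hij
      have hu : wordMat u = wordMat u' :=
        calc wordMat u = M i * M i * wordMat u := by rw [M_mul_self, one_mul]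
          _ = M i * wordMat (i :: u') := by rw [mul_assoc, ← wordMat_cons, h]
          _ = wordMat u' := by rw [wordMat_cons, ← mul_assoc, M_mul_self, one_mul]
      have hru : u.IsChain (· ≠ ·) := hred.tail
      have hru' : u'.IsChain (· ≠ ·) := hred'.tail
      rw [eq_of_wordMat_eq hru hru' hu]

/-! ### Action on integer vectors: no return to the lattice, trivial stabiliser of `D₊` -/

/-- A rank-one matrix times a vector. -/
theorem smul_vecMulVec_mulVec {R : Type*} [CommRing R] (ε : R) (u v x : Fin 3 → R) :
    (ε • vecMulVec u v) *ᵥ x = (ε * (v ⬝ᵥ x)) • u := by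
  ext a
  simp only [Matrix.mulVec, dotProduct, Matrix.smul_apply, vecMulVec_apply, smul_eq_mul, Pi.smul_apply,
    Fin.sum_univ_three]
  ring

/-- The entries of the normals are units mod `3`. -/
theorem nbar_apply_ne_zero : ∀ (h : Fin 4) (a : Fin 3), nbar h a ≠ 0 := by decide

/-- `ZMod 3` has no zero divisors (kernel-decided, no `Fact` instance needed). -/
theorem zmod3_mul_mul_ne_zero : ∀ ε x y : ZMod 3, ε ≠ 0 → x ≠ 0 → y ≠ 0 → ε * x * y ≠ 0 := by decide

/-- **NO RETURN TO THE LATTICE (mod-`3` form).**  For a non-empty reduced word with last letter `l` and an integer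
vector `x` with `n_l ⬝ x ≢ 0 (mod 3)`, no coordinate of `N_w x` is divisible by `3`. -/
theorem not_dvd_wordMatZ_mulVec (w : List (Fin 4)) (hw : w ≠ []) (hred : w.IsChain (· ≠ ·)) (x : Fin 3 → ℤ)
    (hx : nbar (w.getLast hw) ⬝ᵥ (fun a => (x a : ZMod 3)) ≠ 0) (a : Fin 3) : ¬ (3 : ℤ) ∣ (wordMatZ w *ᵥ x) a := by
  obtain ⟨ε, hε, hP⟩ := red_wordMatZ w hw hred
  intro hd
  have h0 : (((wordMatZ w *ᵥ x) a : ℤ) : ZMod 3) = 0 := (ZMod.intCast_zmod_eq_zero_iff_dvd _ 3).2 (by exact_mod_cast hd)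
  have hcast : (((wordMatZ w *ᵥ x) a : ℤ) : ZMod 3) = (red (wordMatZ w) *ᵥ fun b => (x b : ZMod 3)) a := by
    simp [Matrix.mulVec, dotProduct, red_apply]
  rw [hcast, hP, smul_vecMulVec_mulVec, Pi.smul_apply, smul_eq_mul] at h0
  have hε0 : ε ≠ 0 := by rcases hε with rfl | rfl <;> decide
  exact zmod3_mul_mul_ne_zero _ _ _ hε0 hx (nbar_apply_ne_zero _ a) h0

/-- Casting `wordMatZ w *ᵥ x` to `ℚ`. -/
theorem castM_mulVec (A : Matrix (Fin 3) (Fin 3) ℤ) (x : Fin 3 → ℤ) :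
    castM A *ᵥ (fun b => (x b : ℚ)) = fun a => ((A *ᵥ x) a : ℚ) := by
  ext a
  simp [Matrix.mulVec, dotProduct, castM_apply]

/-- **NO RETURN TO THE LATTICE.**  For a non-empty reduced word `w` with last letter `l` and an integer vector `x` with
`n_l ⬝ x ≢ 0 (mod 3)`, NO coordinate of `M_w x` is an integer (each has denominator exactly `3^k`). -/
theorem wordMat_mulVec_apply_ne_intCast (w : List (Fin 4)) (hw : w ≠ []) (hred : w.IsChain (· ≠ ·)) (x : Fin 3 → ℤ)
    (hx : nbar (w.getLast hw) ⬝ᵥ (fun a => (x a : ZMod 3)) ≠ 0) (a : Fin 3) (z : ℤ) :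
    (wordMat w *ᵥ fun b => (x b : ℚ)) a ≠ z := by
  rw [wordMat_eq, Matrix.smul_mulVec, castM_mulVec, Pi.smul_apply, smul_eq_mul, one_div, inv_pow, mul_comm,
    ← div_eq_mul_inv]
  exact div_pow_ne_intCast (by simpa using List.length_pos_of_ne_nil hw |>.ne') (not_dvd_wordMatZ_mulVec w hw hred x hx a) z

end ReflWord

end Summit.Ventures.Crystal3D.Theorems
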